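import Literature.AlgebraicGeometry.Frobenioids.EquivalenceFrobeniusEndomorphismsFromPreSteps
import Literature.AlgebraicGeometry.Frobenioids.EquivalenceFrobeniusType
import HarnessLib

/-!
# Frobenioids I, §3: Theorem 3.4 (iii) — prime-Frobenius morphisms and Frobenius type, from the
# CONCLUSION of Theorem 3.4 (ii) (isotropic type, non-dilating monoids; no hypothesis on the bases)

Mochizuki, *The geometry of Frobenioids I: the general theory*, Kyushu J. Math. **62** (2008),
Thm. 3.4 (iii), proof, kurims pp. 64–65: "(F1) `Ψ` induces a bijection between the prime-Frobenius
morphisms `A₁ → B₁` and the prime-Frobenius morphisms `A₂ → B₂` … (F2) if `A₁` satisfies (F1) and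
`A₁ → A₁'` is either a pre-step or a pull-back morphism then `A₁'` satisfies (F1) …"
[cite: MochizukiFrdI2008, Thm. 3.4 (iii) p.65].

PROOF-ONLY (seat abc-iut-L1-t13, gen 2). Second file of the `…FromPreSteps` re-run of this lineage's
Thm. 3.4 (iii) chain (see `EquivalenceFrobeniusEndomorphismsFromPreSteps.lean` for the programme):
the proofs of `EquivalenceFrobeniusType.lean` (p410153) with the base hypothesis "`D₁`, `D₂` of
FSM-type" replaced by the abstract conclusions of Thm. 3.4 (ii) — `hps`/`hps'` (`Ψ`, `Ψ⁻¹` preserve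
pre-steps), `hgl'` (`Ψ⁻¹` preserves group-like objects). Results: for Frobenioids `C₁`, `C₂` of
isotropic type with `Φ₂` non-dilating, `C₁` admitting a non-group-like object, and an equivalence `Ψ`
satisfying these, `Ψ` maps prime-Frobenius morphisms to prime-Frobenius morphisms
(`FrdI.isPrimeFrobenius_map_ps`), the degree of the image depends only on the degree
(`FrdI.degFr_map_eq_of_degFr_eq_ps`), and `Ψ` preserves morphisms of Frobenius type
(`FrdI.isFrobeniusType_map_ps`). No statement of the paper is restated or strengthened.
-/

set_option backward.isDefEq.respectTransparency false

namespace Literature.AlgebraicGeometry.Frobenioids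

open CategoryTheory Opposite

universe w v v' u u'

namespace FrdI

section Two

variable {D₁ : Type u} [Category.{v} D₁] {Φ₁ : D₁ᵒᵖ ⥤ CommMonCat.{w}} {C₁ : Type u'}
  [Category.{v'} C₁] {D₂ : Type u} [Category.{v} D₂] {Φ₂ : D₂ᵒᵖ ⥤ CommMonCat.{w}} {C₂ : Type u'}
  [Category.{v'} C₂] {F₁ : C₁ ⥤ ElemFrobenioid Φ₁} {F₂ : C₂ ⥤ ElemFrobenioid Φ₂}

/-! ### Prime-Frobenius morphisms out of non-group-like objects are preserved -/

/-- **Thm. 3.4 (iii), (F1)+(F2): `Ψ` maps prime-Frobenius morphisms out of NON-GROUP-LIKE objects to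
prime-Frobenius morphisms** (Frobenioids of isotropic type, `Φ₂` non-dilating; `Ψ`, `Ψ⁻¹` preserve
pre-steps and `Ψ⁻¹` preserves group-like objects): a base-isomorphic Frobenius-trivial object `T`
(Def. 1.3 (i)(a)) is reached from the domain by a span of pre-steps (Def. 1.3 (i)(b)); its
base-identity `p`-Frobenius endomorphism is mapped to a prime-Frobenius endomorphism by (F1), and (F2)
carries this back along the two pre-steps. [cite: MochizukiFrdI2008, Thm. 3.4 (iii) p.65] -/
theorem isPrimeFrobenius_map_of_not_isGroupLikeObj_ps (hF₁ : PreFrobenioid.IsFrobenioid F₁)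
    (hF₂ : PreFrobenioid.IsFrobenioid F₂) (hi₁ : ∀ A : C₁, PreFrobenioid.IsIsotropic F₁ A)
    (hi₂ : ∀ A : C₂, PreFrobenioid.IsIsotropic F₂ A) (hnd₂ : IsNonDilatingOn Φ₂) (Ψ : C₁ ≌ C₂)
    (hps : ∀ ⦃X Y : C₁⦄ ⦃f : X ⟶ Y⦄, PreFrobenioid.IsPreStep F₁ f →
      PreFrobenioid.IsPreStep F₂ (Ψ.functor.map f))
    (hps' : ∀ ⦃X Y : C₂⦄ ⦃g : X ⟶ Y⦄, PreFrobenioid.IsPreStep F₂ g →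
      PreFrobenioid.IsPreStep F₁ (Ψ.inverse.map g))
    (hgl' : ∀ ⦃Y : C₂⦄, PreFrobenioid.IsGroupLikeObj F₂ Y →
      PreFrobenioid.IsGroupLikeObj F₁ (Ψ.inverse.obj Y))
    {A A' : C₁} (hA : ¬ PreFrobenioid.IsGroupLikeObj F₁ A)
    {f : A ⟶ A'} (hf : PreFrobenioid.IsPrimeFrobenius F₁ f) :
    PreFrobenioid.IsPrimeFrobenius F₂ (Ψ.functor.map f) := by
  have hP₁ := hF₁.isPreFrobenioid
  -- a Frobenius-trivial object over the base of `A`, and a span of pre-steps `A ← X → T`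
  obtain ⟨T, hT, ⟨e⟩⟩ := hF₁.i_a (PreFrobenioid.baseObj F₁ A)
  obtain ⟨X, φ, ψ, hφ, hψ, -⟩ := hF₁.i_b A T e.symm
  -- the `p`-Frobenius endomorphism of `T` and the `p`-Frobenius morphism out of `X`
  obtain ⟨ζ, hζ⟩ := hT
  obtain ⟨hζd, hζb, hζF⟩ := hζ (PreFrobenioid.degFr F₁ f)
  obtain ⟨X', fX, hfX, hfXd⟩ := hF₁.ii_exists X (PreFrobenioid.degFr F₁ f)
  -- `T` is not group-like (it is base-isomorphic to `A` through `X`)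
  have hT' : ¬ PreFrobenioid.IsGroupLikeObj F₁ T := fun h =>
    hA (isGroupLikeObj_of_isBaseIso hP₁ φ (isGroupLikeObj_of_isBaseIso' hP₁ ψ hψ.2 h))
  -- (F1) at `T`
  have hζdi : PreFrobenioid.IsDivIdentity F₁ (ζ (PreFrobenioid.degFr F₁ f)) := by
    change pull Φ₁ (PreFrobenioid.Base F₁ _) = MonoidHom.id _
    rw [show PreFrobenioid.Base F₁ (ζ (PreFrobenioid.degFr F₁ f)) = 𝟙 _ from hζb]
    exact MonoidHom.ext fun x => pull_id Φ₁ _ x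
  have hζp : PreFrobenioid.IsPrimeFrobenius F₁ (ζ (PreFrobenioid.degFr F₁ f)) :=
    ⟨hζF, by rw [hζd]; exact hf.2⟩
  have h1 := (isDivIdentity_isPrimeFrobenius_map_ps hF₁ hF₂ hi₁ hi₂ hnd₂ Ψ hps hps' hgl' hT' hζdi hζp).2
  -- (F2) along `ψ : X → T`, then along `φ : X → A`
  have h2 : PreFrobenioid.IsPrimeFrobenius F₂ (Ψ.functor.map fX) :=
    (isPrimeFrobenius_map_iff_of_isPreStep_ps hF₁ hF₂ hi₁ hi₂ Ψ hps hψ hfX hζF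
      (hfXd.trans hζd.symm) (by rw [hfXd]; exact hf.2)).1.2 h1
  exact (isPrimeFrobenius_map_iff_of_isPreStep_ps hF₁ hF₂ hi₁ hi₂ Ψ hps hφ hfX hf.1 hfXd
    (by rw [hfXd]; exact hf.2)).1.1 h2

/-! ### Transport of admissibility through the base category (Def. 1.3 (i)(a)–(c)) -/

/-- Transport of admissibility between objects with isomorphic bases (Def. 1.3 (i)(b): a span of
pre-steps; (F2), pre-step case; `Ψ` preserves pre-steps). [cite: MochizukiFrdI2008, Thm. 3.4 (iii) p.64] -/
theorem admissible_of_baseIso_ps (hF₁ : PreFrobenioid.IsFrobenioid F₁)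
    (hF₂ : PreFrobenioid.IsFrobenioid F₂) (hi₁ : ∀ A : C₁, PreFrobenioid.IsIsotropic F₁ A)
    (hi₂ : ∀ A : C₂, PreFrobenioid.IsIsotropic F₂ A) (Ψ : C₁ ≌ C₂)
    (hps : ∀ ⦃X Y : C₁⦄ ⦃f : X ⟶ Y⦄, PreFrobenioid.IsPreStep F₁ f →
      PreFrobenioid.IsPreStep F₂ (Ψ.functor.map f))
    {p p' : ℕ+} (hp : (p : ℕ).Prime) {A B : C₁}
    (e : PreFrobenioid.baseObj F₁ A ≅ PreFrobenioid.baseObj F₁ B)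
    (hA : (∀ ⦃A₁' : C₁⦄ (f : A ⟶ A₁'), PreFrobenioid.IsFrobeniusType F₁ f → PreFrobenioid.degFr F₁ f = p →
      PreFrobenioid.IsPrimeFrobenius F₂ (Ψ.functor.map f) ∧ PreFrobenioid.degFr F₂ (Ψ.functor.map f) = p')) :
    (∀ ⦃A₂' : C₁⦄ (f : B ⟶ A₂'), PreFrobenioid.IsFrobeniusType F₁ f → PreFrobenioid.degFr F₁ f = p →
      PreFrobenioid.IsPrimeFrobenius F₂ (Ψ.functor.map f) ∧ PreFrobenioid.degFr F₂ (Ψ.functor.map f) = p') := by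
  obtain ⟨X, φ, ψ, hφ, hψ, -⟩ := hF₁.i_b A B e
  obtain ⟨A', f, hf, hfd⟩ := hF₁.ii_exists A p
  obtain ⟨X', fX, hfX, hfXd⟩ := hF₁.ii_exists X p
  obtain ⟨B', g, hg, hgd⟩ := hF₁.ii_exists B p
  have hpX : (PreFrobenioid.degFr F₁ fX : ℕ).Prime := by rw [hfXd]; exact hp
  obtain ⟨hΨf, hΨfd⟩ := hA f hf hfd
  obtain ⟨hiffA, hdegA⟩ := isPrimeFrobenius_map_iff_of_isPreStep_ps hF₁ hF₂ hi₁ hi₂ Ψ hps hφ hfX hf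
    (hfXd.trans hfd.symm) hpX
  obtain ⟨hiffB, hdegB⟩ := isPrimeFrobenius_map_iff_of_isPreStep_ps hF₁ hF₂ hi₁ hi₂ Ψ hps hψ hfX hg
    (hfXd.trans hgd.symm) hpX
  exact admissible_of_rep hF₁ hF₂ Ψ hg hgd (hiffB.1 (hiffA.2 hΨf)) (hdegB ▸ hdegA ▸ hΨfd)

/-- Transport of admissibility ALONG AN ARROW OF THE BASE `u : P → Q` (both directions): through a
Frobenius-trivial object over `Q` (Def. 1.3 (i)(a)), a pull-back morphism over `u` into it (Def. 1.3
(i)(c)) and the lifted Frobenius endomorphism ((F2), pull-back case).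
[cite: MochizukiFrdI2008, Thm. 3.4 (iii) p.65] -/
theorem admissible_iff_of_base_hom_ps (hF₁ : PreFrobenioid.IsFrobenioid F₁)
    (hF₂ : PreFrobenioid.IsFrobenioid F₂) (hi₁ : ∀ A : C₁, PreFrobenioid.IsIsotropic F₁ A)
    (hi₂ : ∀ A : C₂, PreFrobenioid.IsIsotropic F₂ A) (Ψ : C₁ ≌ C₂)
    (hps : ∀ ⦃X Y : C₁⦄ ⦃f : X ⟶ Y⦄, PreFrobenioid.IsPreStep F₁ f →
      PreFrobenioid.IsPreStep F₂ (Ψ.functor.map f))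
    {p p' : ℕ+} (hp : (p : ℕ).Prime) {P Q : D₁} (u : P ⟶ Q) {A B : C₁}
    (eA : PreFrobenioid.baseObj F₁ A ≅ P) (eB : PreFrobenioid.baseObj F₁ B ≅ Q) :
    (∀ ⦃A₁' : C₁⦄ (f : A ⟶ A₁'), PreFrobenioid.IsFrobeniusType F₁ f → PreFrobenioid.degFr F₁ f = p →
      PreFrobenioid.IsPrimeFrobenius F₂ (Ψ.functor.map f) ∧ PreFrobenioid.degFr F₂ (Ψ.functor.map f) = p') ↔
    (∀ ⦃A₂' : C₁⦄ (f : B ⟶ A₂'), PreFrobenioid.IsFrobeniusType F₁ f → PreFrobenioid.degFr F₁ f = p →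
      PreFrobenioid.IsPrimeFrobenius F₂ (Ψ.functor.map f) ∧ PreFrobenioid.degFr F₂ (Ψ.functor.map f) = p') := by
  -- a Frobenius-trivial `T` over `Q`, a pull-back `ζ : W → T` over `u`, with `W` over `P`
  obtain ⟨T, hT, ⟨eT⟩⟩ := hF₁.i_a Q
  obtain ⟨W, ζ, i, hζ, -⟩ := exists_isPullbackMorphism_over' hF₁ T (u ≫ eT.inv)
  obtain ⟨z, hz⟩ := hT
  obtain ⟨hzd, hzb, hzF⟩ := hz p
  obtain ⟨φ, hφF, -, hφd, hsq⟩ := exists_frobenius_endo_lift hF₁ hi₁ hζ hzF hzb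
  have hzp : PreFrobenioid.IsPrimeFrobenius F₁ (z p) := ⟨hzF, by rw [hzd]; exact hp⟩
  have hφp : PreFrobenioid.IsPrimeFrobenius F₁ φ := ⟨hφF, by rw [hφd, hzd]; exact hp⟩
  obtain ⟨hiff, hdeg⟩ := isPrimeFrobenius_map_iff_of_isPullbackMorphism hF₁ hF₂ hi₁ hi₂ Ψ hφp hzp hsq
  constructor
  · intro hA
    obtain ⟨h1, h2⟩ := admissible_of_baseIso_ps hF₁ hF₂ hi₁ hi₂ Ψ hps hp (eA.trans i.symm) hA φ hφF
      (hφd.trans hzd)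
    exact admissible_of_baseIso_ps hF₁ hF₂ hi₁ hi₂ Ψ hps hp (eT.trans eB.symm)
      (admissible_of_rep hF₁ hF₂ Ψ hzF hzd (hiff.1 h1) (hdeg ▸ h2))
  · intro hB
    obtain ⟨h1, h2⟩ := admissible_of_baseIso_ps hF₁ hF₂ hi₁ hi₂ Ψ hps hp (eB.trans eT.symm) hB (z p)
      hzF hzd
    exact admissible_of_baseIso_ps hF₁ hF₂ hi₁ hi₂ Ψ hps hp (i.trans eA.symm)
      (admissible_of_rep hF₁ hF₂ Ψ hφF (hφd.trans hzd) (hiff.2 h1) (hdeg.symm ▸ h2))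

/-- **Thm. 3.4 (iii): `Ψ` maps `p`-Frobenius morphisms to `p'`-Frobenius morphisms for a single prime
`p'` depending only on `p`**, for Frobenioids of isotropic type with `Φ₂` non-dilating, provided `C₁`
has a non-group-like object and `Ψ`, `Ψ⁻¹` preserve pre-steps, `Ψ⁻¹` preserves group-like objects:
(F1) at a base-isomorphic Frobenius-trivial object, (F2) along pre-steps and pull-backs, connectedness
of the base. [cite: MochizukiFrdI2008, Thm. 3.4 (iii) p.65] -/
theorem exists_admissible_all_ps (hF₁ : PreFrobenioid.IsFrobenioid F₁)
    (hF₂ : PreFrobenioid.IsFrobenioid F₂) (hi₁ : ∀ A : C₁, PreFrobenioid.IsIsotropic F₁ A)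
    (hi₂ : ∀ A : C₂, PreFrobenioid.IsIsotropic F₂ A) (hnd₂ : IsNonDilatingOn Φ₂) (Ψ : C₁ ≌ C₂)
    (hps : ∀ ⦃X Y : C₁⦄ ⦃f : X ⟶ Y⦄, PreFrobenioid.IsPreStep F₁ f →
      PreFrobenioid.IsPreStep F₂ (Ψ.functor.map f))
    (hps' : ∀ ⦃X Y : C₂⦄ ⦃g : X ⟶ Y⦄, PreFrobenioid.IsPreStep F₂ g →
      PreFrobenioid.IsPreStep F₁ (Ψ.inverse.map g))
    (hgl' : ∀ ⦃Y : C₂⦄, PreFrobenioid.IsGroupLikeObj F₂ Y →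
      PreFrobenioid.IsGroupLikeObj F₁ (Ψ.inverse.obj Y))
    {N : C₁} (hN : ¬ PreFrobenioid.IsGroupLikeObj F₁ N) (p : ℕ+) (hp : (p : ℕ).Prime) :
    ∃ p' : ℕ+, (p' : ℕ).Prime ∧ ∀ A : C₁, (∀ ⦃A₃' : C₁⦄ (f : A ⟶ A₃'), PreFrobenioid.IsFrobeniusType F₁ f →
      PreFrobenioid.degFr F₁ f = p →
      PreFrobenioid.IsPrimeFrobenius F₂ (Ψ.functor.map f) ∧ PreFrobenioid.degFr F₂ (Ψ.functor.map f) = p') := by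
  have hP₁ := hF₁.isPreFrobenioid
  -- the value `p'`: the degree of the image of the `p`-Frobenius out of `N`
  obtain ⟨N', f₀, hf₀, hf₀d⟩ := hF₁.ii_exists N p
  have hf₀p : PreFrobenioid.IsPrimeFrobenius F₁ f₀ := ⟨hf₀, by rw [hf₀d]; exact hp⟩
  have hΨf₀ := isPrimeFrobenius_map_of_not_isGroupLikeObj_ps hF₁ hF₂ hi₁ hi₂ hnd₂ Ψ hps hps' hgl' hN hf₀p
  refine ⟨PreFrobenioid.degFr F₂ (Ψ.functor.map f₀), hΨf₀.2, ?_⟩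
  -- admissibility of all objects over a given base object is constant along the (connected) base
  let S : D₁ → Prop := fun P => ∀ ⦃B : C₁⦄, Nonempty (PreFrobenioid.baseObj F₁ B ≅ P) →
    (∀ ⦃A₄' : C₁⦄ (f : B ⟶ A₄'), PreFrobenioid.IsFrobeniusType F₁ f → PreFrobenioid.degFr F₁ f = p →
      PreFrobenioid.IsPrimeFrobenius F₂ (Ψ.functor.map f) ∧
        PreFrobenioid.degFr F₂ (Ψ.functor.map f) = PreFrobenioid.degFr F₂ (Ψ.functor.map f₀))
  have hstep : ∀ {P Q : D₁}, Nonempty (P ⟶ Q) ∨ Nonempty (Q ⟶ P) → (S P ↔ S Q) := by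
    have one : ∀ {P Q : D₁} (u : P ⟶ Q), S P → S Q := by
      intro P Q u hP B ⟨eB⟩
      obtain ⟨TA, -, ⟨eA⟩⟩ := hF₁.i_a P
      exact (admissible_iff_of_base_hom_ps hF₁ hF₂ hi₁ hi₂ Ψ hps hp u eA eB).1 (hP ⟨eA⟩)
    have two : ∀ {P Q : D₁} (u : P ⟶ Q), S Q → S P := by
      intro P Q u hQ A ⟨eA⟩
      obtain ⟨TB, -, ⟨eB⟩⟩ := hF₁.i_a Q
      exact (admissible_iff_of_base_hom_ps hF₁ hF₂ hi₁ hi₂ Ψ hps hp u eA eB).2 (hQ ⟨eB⟩)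
    intro P Q h
    rcases h with ⟨⟨u⟩⟩ | ⟨⟨u⟩⟩
    · exact ⟨one u, two u⟩
    · exact ⟨two u, one u⟩
  have hconst : ∀ P Q : D₁, S P ↔ S Q := by
    intro P Q
    induction hP₁.isGraphConnected_base.zigzag P Q with
    | refl => exact Iff.rfl
    | tail _ hbc ih => exact ih.trans (hstep hbc)
  have hSN : S (PreFrobenioid.baseObj F₁ N) := fun B ⟨eB⟩ =>
    admissible_of_baseIso_ps hF₁ hF₂ hi₁ hi₂ Ψ hps hp eB.symm
      (admissible_of_rep hF₁ hF₂ Ψ hf₀ hf₀d hΨf₀ rfl)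
  exact fun A => (hconst _ _).1 hSN ⟨Iso.refl _⟩

/-- **Thm. 3.4 (iii): `Ψ` maps prime-Frobenius morphisms to prime-Frobenius morphisms** (isotropic
type, `Φ₂` non-dilating, `C₁` with a non-group-like object; `Ψ`, `Ψ⁻¹` preserve pre-steps, `Ψ⁻¹`
preserves group-like objects). [cite: MochizukiFrdI2008, Thm. 3.4 (iii) p.65] -/
theorem isPrimeFrobenius_map_ps (hF₁ : PreFrobenioid.IsFrobenioid F₁)
    (hF₂ : PreFrobenioid.IsFrobenioid F₂) (hi₁ : ∀ A : C₁, PreFrobenioid.IsIsotropic F₁ A)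
    (hi₂ : ∀ A : C₂, PreFrobenioid.IsIsotropic F₂ A) (hnd₂ : IsNonDilatingOn Φ₂) (Ψ : C₁ ≌ C₂)
    (hps : ∀ ⦃X Y : C₁⦄ ⦃f : X ⟶ Y⦄, PreFrobenioid.IsPreStep F₁ f →
      PreFrobenioid.IsPreStep F₂ (Ψ.functor.map f))
    (hps' : ∀ ⦃X Y : C₂⦄ ⦃g : X ⟶ Y⦄, PreFrobenioid.IsPreStep F₂ g →
      PreFrobenioid.IsPreStep F₁ (Ψ.inverse.map g))
    (hgl' : ∀ ⦃Y : C₂⦄, PreFrobenioid.IsGroupLikeObj F₂ Y →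
      PreFrobenioid.IsGroupLikeObj F₁ (Ψ.inverse.obj Y))
    {N : C₁} (hN : ¬ PreFrobenioid.IsGroupLikeObj F₁ N)
    {A A' : C₁} {f : A ⟶ A'} (hf : PreFrobenioid.IsPrimeFrobenius F₁ f) :
    PreFrobenioid.IsPrimeFrobenius F₂ (Ψ.functor.map f) := by
  obtain ⟨p', -, hall⟩ := exists_admissible_all_ps hF₁ hF₂ hi₁ hi₂ hnd₂ Ψ hps hps' hgl' hN
    (PreFrobenioid.degFr F₁ f) hf.2
  exact (hall A f hf.1 rfl).1

/-- **Thm. 3.4 (iii): the Frobenius degree of the image of a prime-Frobenius morphism depends only on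
its degree** (the assignment `p ↦ p'` of the printed proof, i.e. `Ψ^{ℕ≥1}` on primes).
[cite: MochizukiFrdI2008, Thm. 3.4 (iii) p.64] -/
theorem degFr_map_eq_of_degFr_eq_ps (hF₁ : PreFrobenioid.IsFrobenioid F₁)
    (hF₂ : PreFrobenioid.IsFrobenioid F₂) (hi₁ : ∀ A : C₁, PreFrobenioid.IsIsotropic F₁ A)
    (hi₂ : ∀ A : C₂, PreFrobenioid.IsIsotropic F₂ A) (hnd₂ : IsNonDilatingOn Φ₂) (Ψ : C₁ ≌ C₂)
    (hps : ∀ ⦃X Y : C₁⦄ ⦃f : X ⟶ Y⦄, PreFrobenioid.IsPreStep F₁ f →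
      PreFrobenioid.IsPreStep F₂ (Ψ.functor.map f))
    (hps' : ∀ ⦃X Y : C₂⦄ ⦃g : X ⟶ Y⦄, PreFrobenioid.IsPreStep F₂ g →
      PreFrobenioid.IsPreStep F₁ (Ψ.inverse.map g))
    (hgl' : ∀ ⦃Y : C₂⦄, PreFrobenioid.IsGroupLikeObj F₂ Y →
      PreFrobenioid.IsGroupLikeObj F₁ (Ψ.inverse.obj Y))
    {N : C₁} (hN : ¬ PreFrobenioid.IsGroupLikeObj F₁ N)
    {A A' B B' : C₁} {f : A ⟶ A'} {g : B ⟶ B'} (hf : PreFrobenioid.IsPrimeFrobenius F₁ f)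
    (hg : PreFrobenioid.IsPrimeFrobenius F₁ g) (hd : PreFrobenioid.degFr F₁ f = PreFrobenioid.degFr F₁ g) :
    PreFrobenioid.degFr F₂ (Ψ.functor.map f) = PreFrobenioid.degFr F₂ (Ψ.functor.map g) := by
  obtain ⟨p', -, hall⟩ := exists_admissible_all_ps hF₁ hF₂ hi₁ hi₂ hnd₂ Ψ hps hps' hgl' hN
    (PreFrobenioid.degFr F₁ f) hf.2
  rw [(hall A f hf.1 rfl).2, (hall B g hg.1 hd.symm).2]

/-- **Thm. 3.4 (iii): `Ψ` preserves morphisms of Frobenius type** (isotropic type, `Φ₂` non-dilating,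
`C₁` with a non-group-like object; `Ψ`, `Ψ⁻¹` preserve pre-steps, `Ψ⁻¹` preserves group-like
objects): composites of prime-Frobenius morphisms (Prop. 1.10 (v)).
[cite: MochizukiFrdI2008, Thm. 3.4 (iii) p.64] -/
theorem isFrobeniusType_map_ps (hF₁ : PreFrobenioid.IsFrobenioid F₁)
    (hF₂ : PreFrobenioid.IsFrobenioid F₂) (hi₁ : ∀ A : C₁, PreFrobenioid.IsIsotropic F₁ A)
    (hi₂ : ∀ A : C₂, PreFrobenioid.IsIsotropic F₂ A) (hnd₂ : IsNonDilatingOn Φ₂) (Ψ : C₁ ≌ C₂)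
    (hps : ∀ ⦃X Y : C₁⦄ ⦃f : X ⟶ Y⦄, PreFrobenioid.IsPreStep F₁ f →
      PreFrobenioid.IsPreStep F₂ (Ψ.functor.map f))
    (hps' : ∀ ⦃X Y : C₂⦄ ⦃g : X ⟶ Y⦄, PreFrobenioid.IsPreStep F₂ g →
      PreFrobenioid.IsPreStep F₁ (Ψ.inverse.map g))
    (hgl' : ∀ ⦃Y : C₂⦄, PreFrobenioid.IsGroupLikeObj F₂ Y →
      PreFrobenioid.IsGroupLikeObj F₁ (Ψ.inverse.obj Y))
    {N : C₁} (hN : ¬ PreFrobenioid.IsGroupLikeObj F₁ N) :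
    ∀ (n : ℕ) {A A' : C₁} {f : A ⟶ A'}, PreFrobenioid.IsFrobeniusType F₁ f →
      (PreFrobenioid.degFr F₁ f : ℕ) = n → PreFrobenioid.IsFrobeniusType F₂ (Ψ.functor.map f) := by
  intro n
  induction n using Nat.strong_induction_on with
  | _ n ih =>
    intro A A' f hf hn
    by_cases h1 : PreFrobenioid.degFr F₁ f = 1
    · haveI := PreFrobenioid.isIso_of_isFrobeniusType_of_degFr_eq_one hF₁ hf h1
      exact PreFrobenioid.isFrobeniusType_of_isIso F₂ hF₂.isPreFrobenioid _
    · have hn1 : n ≠ 1 := fun h => h1 (PNat.eq (by rw [PNat.one_coe, ← h, hn]))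
      have hp : (Nat.minFac n).Prime := Nat.minFac_prime hn1
      obtain ⟨k, hk⟩ := Nat.minFac_dvd n
      have hnpos : 0 < n := by rw [← hn]; exact PNat.pos _
      have hkpos : 0 < k := Nat.pos_of_ne_zero fun h0 => by
        rw [h0, mul_zero] at hk; exact hnpos.ne' hk
      obtain ⟨X, μ, ν, hμν, hμ, hμd, hν, hνd⟩ := PreFrobenioid.exists_split_of_isFrobeniusType hF₁ hf
        ⟨Nat.minFac n, Nat.minFac_pos n⟩ ⟨k, hkpos⟩ (PNat.eq (by rw [PNat.mul_coe, hn]; exact hk))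
      have hμp : PreFrobenioid.IsPrimeFrobenius F₁ μ := ⟨hμ, by rw [hμd]; exact hp⟩
      have hklt : k < n := by
        rw [hk]
        exact lt_mul_left hkpos hp.one_lt
      rw [← hμν, Functor.map_comp]
      exact PreFrobenioid.IsFrobeniusType.comp F₂ hF₂
        (isPrimeFrobenius_map_ps hF₁ hF₂ hi₁ hi₂ hnd₂ Ψ hps hps' hgl' hN hμp).1
        (ih k hklt hν (by rw [hνd]; rfl))

end Two

end FrdI

end Literature.AlgebraicGeometry.Frobenioids
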